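import Mathlib
import Summits.MatrixMultiplication.MatrixMultiplication.Theses.SemilatticeSTPP
import Summits.MatrixMultiplication.MatrixMultiplication.Theorems.Thesis.Negative.SemilatticeSTPPVolumeFloor

/-!
# Line `registered` of crux `SemilatticeSTPP.Thesis` (stmt-MatrixMultiplication-5969):
# the semilattice counting toolkit — γ-values avoid α- and β-values, α- and β-values avoid `1`,
# and the two counting bounds `#Z + #X ≤ |M|`, `#Z + #Y ≤ |M|`

Hosts here are SEMILATTICES = commutative idempotent monoids (product = join, identity `1` = bottom), with the
natural order `v ≤ w :↔ v * w = w`.  For a monoid-TPP family in iff-form (`α x * β y = γ z ⟺` the indices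
match), the matched identities `α(s,t) · β(t,u) = γ(s,u)` inside a block give the order facts `α(s,t) ≤ γ(s,u)` and
`β(t,u) ≤ γ(s,u)`, while the iff says that every other product `α x · β y` misses every γ-value.  This file proves:

* `alpha_ne_gamma_of_idempotent` — an α-value of a block with `b ≥ 2` is never a γ-value of a block with `b ≥ 1`:
  if `α x = γ z` with `z = (k; s', u')` then every `β(k; t'', u') ≤ γ z = α x` is absorbed, `α x · β(k;t'',u') = γ z`,
  and the iff pins every `t'' : Fin (b k)` to the single value `t` — impossible for `b k = b i ≥ 2`.
* `beta_ne_gamma_of_idempotent` — the mirror statement for β-values (absorb `α(k; s', t'') ≤ γ z = β y`).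
* `alpha_ne_one_of_idempotent`, `beta_ne_one_of_idempotent` — an α-value (resp. β-value) of a block with `b ≥ 2`
  and `c ≥ 1` (resp. `a ≥ 1`) is never the identity: `α(s,t) = 1` makes `γ(s,u) = β(t,u)`, so every
  `α(s,t') ≤ γ(s,u)` gives `α(s,t') · β(t,u) = γ(s,u)` and the iff pins every `t'` to `t`.
* `card_ge_gamma_add_alpha_of_idempotent`, `card_ge_gamma_add_beta_of_idempotent` — hence the γ-values over the
  blocks with `b ≥ 1` and the α-values over the blocks with `b ≥ 2, c ≥ 1` (resp. the β-values over the blocks with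
  `b ≥ 2, a ≥ 1`) are pairwise distinct elements of `M` (injectivity on blocks is `gamma_injective_of_tpp`,
  `alpha_injective_of_tpp`, `beta_injective_of_tpp` of the volume-floor file), so
  `Σ_{b≥1} aᵢcᵢ + Σ_{b≥2, c≥1} aᵢbᵢ ≤ |M|` and `Σ_{b≥1} aᵢcᵢ + Σ_{b≥2, a≥1} bᵢcᵢ ≤ |M|`.

Mathlib + the route file + the volume-floor injectivity lemmas only; no cited facts; sorry-free.
-/

set_option linter.dupNamespace false
-- (single-conjunct summit: the namespace repeats `MatrixMultiplication`)

namespace Summit.MatrixMultiplication.MatrixMultiplication.Theorems.SemilatticeSTPPThesis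

open Summit.MatrixMultiplication.MatrixMultiplication.Theorems.Thesis.Negative.SemilatticeSTPPVolumeFloor

/-- **γ-values avoid α-values.**  In a commutative idempotent host of a monoid-TPP family (iff-form), an α-value
of a block `i` with `2 ≤ b i` differs from every γ-value of a block `k` with `1 ≤ b k`: if `α x = γ z` with
`z = (k; s', u')`, then for every `t'' : Fin (b k)` the matched identity `α(k;s',t'')·β(k;t'',u') = γ z` gives
`β(k;t'',u') ≤ γ z`, so `α x · β(k;t'',u') = γ z · β(k;t'',u') = γ z`, and the TPP iff forces `k = i` and
`(t : ℕ) = t''` for every `t''` — contradicting `2 ≤ b i` (take `t'' = 0, 1`). [folklore] -/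
theorem alpha_ne_gamma_of_idempotent :
    ∀ (M : Type) [CommMonoid M], (∀ v : M, v * v = v) →
      ∀ (p : ℕ) (a b c : Fin p → ℕ) (α : (Σ i, Fin (a i) × Fin (b i)) → M)
        (β : (Σ i, Fin (b i) × Fin (c i)) → M) (γ : (Σ i, Fin (a i) × Fin (c i)) → M),
        (∀ x y z, α x * β y = γ z ↔
          (z.1 = x.1 ∧ x.1 = y.1 ∧ (z.2.1 : ℕ) = x.2.1 ∧ (x.2.2 : ℕ) = y.2.1 ∧ (z.2.2 : ℕ) = y.2.2)) →
        ∀ (x : Σ i, Fin (a i) × Fin (b i)) (z : Σ i, Fin (a i) × Fin (c i)),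
          2 ≤ b x.1 → 1 ≤ b z.1 → α x ≠ γ z := by
  intro M _ hid p a b c α β γ htpp x z hbx hbz hxz
  obtain ⟨i, s, t⟩ := x
  obtain ⟨k, s', u'⟩ := z
  simp only at hbx hbz
  -- every β-value of block `k` in column `u'` lies below `γ z = α x`, so the iff pins its row index to `t`
  have key : ∀ t'' : Fin (b k), k = i ∧ (t : ℕ) = t'' := fun t'' => by
    have hm : α ⟨k, (s', t'')⟩ * β ⟨k, (t'', u')⟩ = γ ⟨k, (s', u')⟩ :=
      (htpp ⟨k, (s', t'')⟩ ⟨k, (t'', u')⟩ ⟨k, (s', u')⟩).2 ⟨rfl, rfl, rfl, rfl, rfl⟩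
    have hprod : α ⟨i, (s, t)⟩ * β ⟨k, (t'', u')⟩ = γ ⟨k, (s', u')⟩ :=
      calc α ⟨i, (s, t)⟩ * β ⟨k, (t'', u')⟩
          = α ⟨k, (s', t'')⟩ * β ⟨k, (t'', u')⟩ * β ⟨k, (t'', u')⟩ := by rw [hxz, ← hm]
        _ = γ ⟨k, (s', u')⟩ := by rw [mul_assoc, hid (β ⟨k, (t'', u')⟩), hm]
    obtain ⟨h1, -, -, h4, -⟩ := (htpp ⟨i, (s, t)⟩ ⟨k, (t'', u')⟩ ⟨k, (s', u')⟩).1 hprod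
    exact ⟨h1, h4⟩
  obtain ⟨hki, -⟩ := key ⟨0, hbz⟩
  subst hki
  have h0 : (t : ℕ) = 0 := (key ⟨0, hbz⟩).2
  have h1 : (t : ℕ) = 1 := (key ⟨1, hbx⟩).2
  omega

/-- **γ-values avoid β-values.**  Mirror image of `alpha_ne_gamma_of_idempotent`: if `β y = γ z` with
`z = (k; s', u')`, then for every `t'' : Fin (b k)` the matched identity gives `α(k;s',t'') ≤ γ z`, so
`α(k;s',t'') · β y = α(k;s',t'') · γ z = γ z`, and the TPP iff forces `k = j` and `(t'' : ℕ) = t` for every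
`t''` — contradicting `2 ≤ b j`. [folklore] -/
theorem beta_ne_gamma_of_idempotent :
    ∀ (M : Type) [CommMonoid M], (∀ v : M, v * v = v) →
      ∀ (p : ℕ) (a b c : Fin p → ℕ) (α : (Σ i, Fin (a i) × Fin (b i)) → M)
        (β : (Σ i, Fin (b i) × Fin (c i)) → M) (γ : (Σ i, Fin (a i) × Fin (c i)) → M),
        (∀ x y z, α x * β y = γ z ↔
          (z.1 = x.1 ∧ x.1 = y.1 ∧ (z.2.1 : ℕ) = x.2.1 ∧ (x.2.2 : ℕ) = y.2.1 ∧ (z.2.2 : ℕ) = y.2.2)) →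
        ∀ (y : Σ i, Fin (b i) × Fin (c i)) (z : Σ i, Fin (a i) × Fin (c i)),
          2 ≤ b y.1 → 1 ≤ b z.1 → β y ≠ γ z := by
  intro M _ hid p a b c α β γ htpp y z hby hbz hyz
  obtain ⟨j, t, u⟩ := y
  obtain ⟨k, s', u'⟩ := z
  simp only at hby hbz
  -- every α-value of block `k` in row `s'` lies below `γ z = β y`, so the iff pins its column index to `t`
  have key : ∀ t'' : Fin (b k), k = j ∧ (t'' : ℕ) = t := fun t'' => by
    have hm : α ⟨k, (s', t'')⟩ * β ⟨k, (t'', u')⟩ = γ ⟨k, (s', u')⟩ :=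
      (htpp ⟨k, (s', t'')⟩ ⟨k, (t'', u')⟩ ⟨k, (s', u')⟩).2 ⟨rfl, rfl, rfl, rfl, rfl⟩
    have hprod : α ⟨k, (s', t'')⟩ * β ⟨j, (t, u)⟩ = γ ⟨k, (s', u')⟩ :=
      calc α ⟨k, (s', t'')⟩ * β ⟨j, (t, u)⟩
          = α ⟨k, (s', t'')⟩ * (α ⟨k, (s', t'')⟩ * β ⟨k, (t'', u')⟩) := by rw [hyz, hm]
        _ = γ ⟨k, (s', u')⟩ := by rw [← mul_assoc, hid (α ⟨k, (s', t'')⟩), hm]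
    obtain ⟨-, h2, -, h4, -⟩ := (htpp ⟨k, (s', t'')⟩ ⟨j, (t, u)⟩ ⟨k, (s', u')⟩).1 hprod
    exact ⟨h2, h4⟩
  obtain ⟨hkj, -⟩ := key ⟨0, hbz⟩
  subst hkj
  have h0 : (0 : ℕ) = t := (key ⟨0, hbz⟩).2
  have h1 : (1 : ℕ) = t := (key ⟨1, hby⟩).2
  omega

/-- **α-values avoid the identity.**  In a commutative idempotent host of a monoid-TPP family (iff-form), an
α-value `α(i;s,t)` of a block with `2 ≤ b i` and `0 < c i` is never `1`: pick `u : Fin (c i)`; `α(s,t) = 1` turns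
the matched identity into `γ(s,u) = β(t,u)`, and for every `t'` the order fact `α(s,t') ≤ γ(s,u)` (from
`α(s,t')·β(t',u) = γ(s,u)` and idempotency) gives `α(s,t')·β(t,u) = α(s,t')·γ(s,u) = γ(s,u)`, so the TPP iff pins
every `t' : Fin (b i)` to `t` — contradicting `2 ≤ b i`. [folklore] -/
theorem alpha_ne_one_of_idempotent :
    ∀ (M : Type) [CommMonoid M], (∀ v : M, v * v = v) →
      ∀ (p : ℕ) (a b c : Fin p → ℕ) (α : (Σ i, Fin (a i) × Fin (b i)) → M)
        (β : (Σ i, Fin (b i) × Fin (c i)) → M) (γ : (Σ i, Fin (a i) × Fin (c i)) → M),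
        (∀ x y z, α x * β y = γ z ↔
          (z.1 = x.1 ∧ x.1 = y.1 ∧ (z.2.1 : ℕ) = x.2.1 ∧ (x.2.2 : ℕ) = y.2.1 ∧ (z.2.2 : ℕ) = y.2.2)) →
        ∀ (x : Σ i, Fin (a i) × Fin (b i)), 2 ≤ b x.1 → 0 < c x.1 → α x ≠ 1 := by
  intro M _ hid p a b c α β γ htpp x hbx hcx hone
  obtain ⟨i, s, t⟩ := x
  simp only at hbx hcx
  set u : Fin (c i) := ⟨0, hcx⟩
  -- matched instances of the TPP iff inside block `i`
  have hm : ∀ t₀ : Fin (b i), α ⟨i, (s, t₀)⟩ * β ⟨i, (t₀, u)⟩ = γ ⟨i, (s, u)⟩ := fun t₀ =>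
    (htpp ⟨i, (s, t₀)⟩ ⟨i, (t₀, u)⟩ ⟨i, (s, u)⟩).2 ⟨rfl, rfl, rfl, rfl, rfl⟩
  -- `α(s,t) = 1` makes `γ(s,u) = β(t,u)`, and every `α(s,t') ≤ γ(s,u)` then matches `β(t,u)`
  have key : ∀ t' : Fin (b i), (t' : ℕ) = t := fun t' => by
    have hprod : α ⟨i, (s, t')⟩ * β ⟨i, (t, u)⟩ = γ ⟨i, (s, u)⟩ :=
      calc α ⟨i, (s, t')⟩ * β ⟨i, (t, u)⟩
          = α ⟨i, (s, t')⟩ * (α ⟨i, (s, t')⟩ * β ⟨i, (t', u)⟩) := by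
            rw [hm t', ← hm t, hone, one_mul]
        _ = γ ⟨i, (s, u)⟩ := by rw [← mul_assoc, hid (α ⟨i, (s, t')⟩), hm t']
    exact ((htpp ⟨i, (s, t')⟩ ⟨i, (t, u)⟩ ⟨i, (s, u)⟩).1 hprod).2.2.2.1
  have h0 : (0 : ℕ) = t := key ⟨0, by omega⟩
  have h1 : (1 : ℕ) = t := key ⟨1, hbx⟩
  omega

/-- **β-values avoid the identity.**  Mirror image of `alpha_ne_one_of_idempotent`: pick `s : Fin (a i)`;
`β(t,u) = 1` turns the matched identity into `γ(s,u) = α(s,t)`, and for every `t'` the order fact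
`β(t',u) ≤ γ(s,u)` gives `α(s,t)·β(t',u) = γ(s,u)·β(t',u) = γ(s,u)`, so the TPP iff pins every `t' : Fin (b i)` to
`t` — contradicting `2 ≤ b i`. [folklore] -/
theorem beta_ne_one_of_idempotent :
    ∀ (M : Type) [CommMonoid M], (∀ v : M, v * v = v) →
      ∀ (p : ℕ) (a b c : Fin p → ℕ) (α : (Σ i, Fin (a i) × Fin (b i)) → M)
        (β : (Σ i, Fin (b i) × Fin (c i)) → M) (γ : (Σ i, Fin (a i) × Fin (c i)) → M),
        (∀ x y z, α x * β y = γ z ↔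
          (z.1 = x.1 ∧ x.1 = y.1 ∧ (z.2.1 : ℕ) = x.2.1 ∧ (x.2.2 : ℕ) = y.2.1 ∧ (z.2.2 : ℕ) = y.2.2)) →
        ∀ (y : Σ i, Fin (b i) × Fin (c i)), 2 ≤ b y.1 → 0 < a y.1 → β y ≠ 1 := by
  intro M _ hid p a b c α β γ htpp y hby hay hone
  obtain ⟨i, t, u⟩ := y
  simp only at hby hay
  set s : Fin (a i) := ⟨0, hay⟩
  -- matched instances of the TPP iff inside block `i`
  have hm : ∀ t₀ : Fin (b i), α ⟨i, (s, t₀)⟩ * β ⟨i, (t₀, u)⟩ = γ ⟨i, (s, u)⟩ := fun t₀ =>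
    (htpp ⟨i, (s, t₀)⟩ ⟨i, (t₀, u)⟩ ⟨i, (s, u)⟩).2 ⟨rfl, rfl, rfl, rfl, rfl⟩
  -- `β(t,u) = 1` makes `γ(s,u) = α(s,t)`, and every `β(t',u) ≤ γ(s,u)` then matches `α(s,t)`
  have key : ∀ t' : Fin (b i), (t : ℕ) = t' := fun t' => by
    have hprod : α ⟨i, (s, t)⟩ * β ⟨i, (t', u)⟩ = γ ⟨i, (s, u)⟩ :=
      calc α ⟨i, (s, t)⟩ * β ⟨i, (t', u)⟩
          = α ⟨i, (s, t')⟩ * β ⟨i, (t', u)⟩ * β ⟨i, (t', u)⟩ := by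
            rw [hm t', ← hm t, hone, mul_one]
        _ = γ ⟨i, (s, u)⟩ := by rw [mul_assoc, hid (β ⟨i, (t', u)⟩), hm t']
    exact ((htpp ⟨i, (s, t)⟩ ⟨i, (t', u)⟩ ⟨i, (s, u)⟩).1 hprod).2.2.2.1
  have h0 : (t : ℕ) = 0 := key ⟨0, by omega⟩
  have h1 : (t : ℕ) = 1 := key ⟨1, hby⟩
  omega

/-- **Counting bound `#Z + #X ≤ |M|`.**  In a finite commutative idempotent host of a monoid-TPP family
(iff-form), the γ-values of the blocks with `1 ≤ b i` (pairwise distinct by `gamma_injective_of_tpp`) and the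
α-values of the blocks with `2 ≤ b i ∧ 1 ≤ c i` (pairwise distinct by `alpha_injective_of_tpp`) are disjoint
families (`alpha_ne_gamma_of_idempotent`), so together they inject into `M`:
`Σ_{1 ≤ bᵢ} aᵢcᵢ + Σ_{2 ≤ bᵢ, 1 ≤ cᵢ} aᵢbᵢ ≤ |M|`. [folklore] -/
theorem card_ge_gamma_add_alpha_of_idempotent :
    ∀ (M : Type) [CommMonoid M] [Fintype M], (∀ v : M, v * v = v) →
      ∀ (p : ℕ) (a b c : Fin p → ℕ) (α : (Σ i, Fin (a i) × Fin (b i)) → M)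
        (β : (Σ i, Fin (b i) × Fin (c i)) → M) (γ : (Σ i, Fin (a i) × Fin (c i)) → M),
        (∀ x y z, α x * β y = γ z ↔
          (z.1 = x.1 ∧ x.1 = y.1 ∧ (z.2.1 : ℕ) = x.2.1 ∧ (x.2.2 : ℕ) = y.2.1 ∧ (z.2.2 : ℕ) = y.2.2)) →
        (∑ i, if 1 ≤ b i then a i * c i else 0) + (∑ i, if 2 ≤ b i ∧ 1 ≤ c i then a i * b i else 0)
          ≤ Fintype.card M := by
  intro M _ _ hid p a b c α β γ htpp
  classical
  set S : Finset (Fin p) := Finset.univ.filter (fun i => 1 ≤ b i) with hS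
  set T : Finset (Fin p) := Finset.univ.filter (fun i => 2 ≤ b i ∧ 1 ≤ c i) with hT
  -- the γ-values over `S` together with the α-values over `T`
  let φ : ((Σ i : S, Fin (a i) × Fin (c i)) ⊕ (Σ i : T, Fin (a i) × Fin (b i))) → M :=
    Sum.elim (fun w => γ ⟨w.1.1, w.2⟩) (fun w => α ⟨w.1.1, w.2⟩)
  have hφ : Function.Injective φ := by
    rintro (⟨⟨i, hi⟩, su⟩ | ⟨⟨i, hi⟩, st⟩) (⟨⟨i', hi'⟩, su'⟩ | ⟨⟨i', hi'⟩, st'⟩) he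
    · -- two γ-values
      have hb : 0 < b i := (Finset.mem_filter.mp hi).2
      have key := gamma_injective_of_tpp α β γ htpp ⟨i, su⟩ ⟨i', su'⟩ hb he
      obtain ⟨rfl, h2⟩ := Sigma.mk.inj_iff.mp key
      cases h2
      rfl
    · -- a γ-value against an α-value
      exact absurd (Eq.symm he) (alpha_ne_gamma_of_idempotent M hid p a b c α β γ htpp ⟨i', st'⟩ ⟨i, su⟩
        (Finset.mem_filter.mp hi').2.1 (Finset.mem_filter.mp hi).2)
    · -- an α-value against a γ-value
      exact absurd he (alpha_ne_gamma_of_idempotent M hid p a b c α β γ htpp ⟨i, st⟩ ⟨i', su'⟩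
        (Finset.mem_filter.mp hi).2.1 (Finset.mem_filter.mp hi').2)
    · -- two α-values
      have hc : 0 < c i := (Finset.mem_filter.mp hi).2.2
      have key := alpha_injective_of_tpp α β γ htpp ⟨i, st⟩ ⟨i', st'⟩ hc he
      obtain ⟨rfl, h2⟩ := Sigma.mk.inj_iff.mp key
      cases h2
      rfl
  have hcard : Fintype.card ((Σ i : S, Fin (a i) × Fin (c i)) ⊕ (Σ i : T, Fin (a i) × Fin (b i)))
      = ∑ i ∈ S, a i * c i + ∑ i ∈ T, a i * b i := by
    rw [Fintype.card_sum, Fintype.card_sigma, Fintype.card_sigma,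
      ← Finset.sum_coe_sort S (fun i => a i * c i), ← Finset.sum_coe_sort T (fun i => a i * b i)]
    simp only [Fintype.card_prod, Fintype.card_fin]
  have hsum : (∑ i, if 1 ≤ b i then a i * c i else 0) + (∑ i, if 2 ≤ b i ∧ 1 ≤ c i then a i * b i else 0)
      = ∑ i ∈ S, a i * c i + ∑ i ∈ T, a i * b i := by
    rw [hS, hT, Finset.sum_filter, Finset.sum_filter]
  rw [hsum, ← hcard]
  exact Fintype.card_le_of_injective φ hφ

/-- **Counting bound `#Z + #Y ≤ |M|`.**  The twin of `card_ge_gamma_add_alpha_of_idempotent` with β in place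
of α: the γ-values of the blocks with `1 ≤ b i` and the β-values of the blocks with `2 ≤ b i ∧ 1 ≤ a i`
(pairwise distinct by `beta_injective_of_tpp`) are disjoint families (`beta_ne_gamma_of_idempotent`), so
`Σ_{1 ≤ bᵢ} aᵢcᵢ + Σ_{2 ≤ bᵢ, 1 ≤ aᵢ} bᵢcᵢ ≤ |M|`. [folklore] -/
theorem card_ge_gamma_add_beta_of_idempotent :
    ∀ (M : Type) [CommMonoid M] [Fintype M], (∀ v : M, v * v = v) →
      ∀ (p : ℕ) (a b c : Fin p → ℕ) (α : (Σ i, Fin (a i) × Fin (b i)) → M)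
        (β : (Σ i, Fin (b i) × Fin (c i)) → M) (γ : (Σ i, Fin (a i) × Fin (c i)) → M),
        (∀ x y z, α x * β y = γ z ↔
          (z.1 = x.1 ∧ x.1 = y.1 ∧ (z.2.1 : ℕ) = x.2.1 ∧ (x.2.2 : ℕ) = y.2.1 ∧ (z.2.2 : ℕ) = y.2.2)) →
        (∑ i, if 1 ≤ b i then a i * c i else 0) + (∑ i, if 2 ≤ b i ∧ 1 ≤ a i then b i * c i else 0)
          ≤ Fintype.card M := by
  intro M _ _ hid p a b c α β γ htpp
  classical
  set S : Finset (Fin p) := Finset.univ.filter (fun i => 1 ≤ b i) with hS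
  set T : Finset (Fin p) := Finset.univ.filter (fun i => 2 ≤ b i ∧ 1 ≤ a i) with hT
  -- the γ-values over `S` together with the β-values over `T`
  let φ : ((Σ i : S, Fin (a i) × Fin (c i)) ⊕ (Σ i : T, Fin (b i) × Fin (c i))) → M :=
    Sum.elim (fun w => γ ⟨w.1.1, w.2⟩) (fun w => β ⟨w.1.1, w.2⟩)
  have hφ : Function.Injective φ := by
    rintro (⟨⟨i, hi⟩, su⟩ | ⟨⟨i, hi⟩, tu⟩) (⟨⟨i', hi'⟩, su'⟩ | ⟨⟨i', hi'⟩, tu'⟩) he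
    · -- two γ-values
      have hb : 0 < b i := (Finset.mem_filter.mp hi).2
      have key := gamma_injective_of_tpp α β γ htpp ⟨i, su⟩ ⟨i', su'⟩ hb he
      obtain ⟨rfl, h2⟩ := Sigma.mk.inj_iff.mp key
      cases h2
      rfl
    · -- a γ-value against a β-value
      exact absurd (Eq.symm he) (beta_ne_gamma_of_idempotent M hid p a b c α β γ htpp ⟨i', tu'⟩ ⟨i, su⟩
        (Finset.mem_filter.mp hi').2.1 (Finset.mem_filter.mp hi).2)
    · -- a β-value against a γ-value
      exact absurd he (beta_ne_gamma_of_idempotent M hid p a b c α β γ htpp ⟨i, tu⟩ ⟨i', su'⟩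
        (Finset.mem_filter.mp hi).2.1 (Finset.mem_filter.mp hi').2)
    · -- two β-values
      have ha : 0 < a i := (Finset.mem_filter.mp hi).2.2
      have key := beta_injective_of_tpp α β γ htpp ⟨i, tu⟩ ⟨i', tu'⟩ ha he
      obtain ⟨rfl, h2⟩ := Sigma.mk.inj_iff.mp key
      cases h2
      rfl
  have hcard : Fintype.card ((Σ i : S, Fin (a i) × Fin (c i)) ⊕ (Σ i : T, Fin (b i) × Fin (c i)))
      = ∑ i ∈ S, a i * c i + ∑ i ∈ T, b i * c i := by
    rw [Fintype.card_sum, Fintype.card_sigma, Fintype.card_sigma,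
      ← Finset.sum_coe_sort S (fun i => a i * c i), ← Finset.sum_coe_sort T (fun i => b i * c i)]
    simp only [Fintype.card_prod, Fintype.card_fin]
  have hsum : (∑ i, if 1 ≤ b i then a i * c i else 0) + (∑ i, if 2 ≤ b i ∧ 1 ≤ a i then b i * c i else 0)
      = ∑ i ∈ S, a i * c i + ∑ i ∈ T, b i * c i := by
    rw [hS, hT, Finset.sum_filter, Finset.sum_filter]
  rw [hsum, ← hcard]
  exact Fintype.card_le_of_injective φ hφ

end Summit.MatrixMultiplication.MatrixMultiplication.Theorems.SemilatticeSTPPThesis
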